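import Mathlib
import Summits.CriticalPhenomena.PercolationContinuityZ3.Theorems.PercNearOneGluingAdditiveGluingOneBond
import Literature.Probability.LatticeModels.ProdBernoulliCoupling
import Literature.Probability.Percolation.PercolationEvents
import HarnessLib

/-!
# Additive Kozma–Nitzan Lemma 13: the additive shortening step implies additive Conjecture 1

Stub `stub_additiveLemma13` of line `additive-shortening` for the crux `PercNearOneGluing.NoHeavyLowerTail`
(item stmt-CriticalPhenomena-4575).

Setting: weights `w : Sym2 (Fin n) → [0,1]`, `μ_w = prodBernoulli w` on bond configurations of the complete graph
on `Fin n` (weight `0` = absent pair), `P_w(x ↔ y) = μ_w(openConn x y)`, `P_w(o ↔ A) = μ_w(⋃ a ∈ A, openConn o a)`.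

The HYPOTHESIS is the registered kernel `stub_additiveShorteningStep` verbatim (the ADDITIVE analogue of
Kozma–Nitzan Conjecture 6, arXiv:2401.12397 §5.3 p. 34, with the induction hypothesis displayed): for `v ∉ A`,
`v ≠ x`, `w s(v,x) = 0`, a minimiser `a₀ ∈ A` of `P_w(· ↔ b)` on `A` and additive Conjecture 1 known for every weight
function supported inside the support of `w`, the additive inequality holds at the glued source in `w[s(v,x) ↦ 1]`
against the OLD minimiser `a₀`.  The CONCLUSION is additive Conjecture 1: for `A ≠ ∅` and `t ≤ P_w(a ↔ b)` on `A`,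
`P_w(o ↔ A) − (1 − t) ≤ P_w(o ↔ b)`.

Proof (the additive rerun of KN Lemma 13, p. 34): strong induction on the number of positive pairs.  If `o ∈ A`
then `P(o ↔ A) ≤ 1` and `t ≤ P(o ↔ b)`.  If `o` has no positive pair then `P(o ↔ A) = 0`
(`addLemma13_reach_eq_zero`: an open `o–a` path starts with an open pair at `o`) and `t ≤ P(a ↔ b) ≤ 1` for some
`a ∈ A`.  Otherwise pick `x` with `w s(o,x) ≠ 0`, let `H₀ := w[s(o,x) ↦ 0]` (fewer positive pairs) and
`H₁ := w[s(o,x) ↦ 1]`, and let `a₀` minimise `P_{H₀}(· ↔ b)` on `A`.  Induction gives `Y₀ − (1 − Z₀) ≤ X₀`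
(`X = P(o ↔ b)`, `Y = P(o ↔ A)`, `Z = P(a₀ ↔ b)`), the step gives `Y₁ − (1 − Z₁) ≤ X₁`, the one-bond decomposition
(`stub_oneBondDecomp_k15`) writes each of `X, Y, Z` at `w` as `(1−p)·(·)₀ + p·(·)₁` with `p = w s(o,x)`, and the
AFFINE identity `X − Y + 1 − Z = (1−p)(X₀ − Y₀ + 1 − Z₀) + p(X₁ − Y₁ + 1 − Z₁) ≥ 0` (`addLemma13_algebra`, no cross
term, no monotonicity needed) concludes, since `t ≤ P_w(a₀ ↔ b) = Z`.

Adapted line by line from the sorry-free multiplicative version (`stub_lemma13` of line `kn_shortening_induction`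
of the sibling crux `NearOneGluing`); auxiliary names carry the prefix `addLemma13_`.
-/

namespace Summit.CriticalPhenomena.PercolationContinuityZ3.Theorems

open MeasureTheory Set Literature.Probability.LatticeModels Literature.Probability.Percolation
open scoped Classical BigOperators

section AddLemma13

variable {n : ℕ}

/-- An open path from `o` to a different vertex `a` begins with an open pair `s(o, x)`, `x ≠ o`. [folklore] -/
theorem addLemma13_exists_open_pair {ω : BondConfig (Fin n)} {o a : Fin n} (hoa : o ≠ a)
    (h : ω ∈ openConn o a) : ∃ x : Fin n, x ≠ o ∧ s(o, x) ∈ ω := by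
  obtain ⟨p⟩ := (h : (openGraph ω).Reachable o a)
  cases p with
  | nil => exact absurd rfl hoa
  | cons hadj _ =>
    have h' := (openGraph_adj ω _ _).1 hadj
    exact ⟨_, fun hx => h'.2 hx.symm, h'.1⟩

/-- If every pair at `o` has weight `0` and `o ∉ A`, then `P(o ↔ A) = 0`: the event `{o ↔ A}` is contained in
"some pair `s(o, x)`, `x ≠ o`, is open", whose probability is at most `∑ₓ w s(o, x) = 0` (union bound). [folklore] -/
theorem addLemma13_reach_eq_zero (w : Sym2 (Fin n) → unitInterval) (A : Finset (Fin n)) {o : Fin n}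
    (hoA : o ∉ A) (hiso : ∀ x : Fin n, x ≠ o → w s(o, x) = 0) :
    (prodBernoulli w).real (⋃ a ∈ A, openConn o a) = 0 := by
  set F : Finset (Sym2 (Fin n)) := (Finset.univ.filter fun x : Fin n => x ≠ o).image fun x => s(o, x)
    with hF
  have hsub : (⋃ a ∈ A, openConn o a : Set (BondConfig (Fin n))) ⊆ {ω | ∃ i ∈ F, i ∈ ω} := by
    intro ω hω
    simp only [mem_iUnion, exists_prop] at hω
    obtain ⟨a, ha, h⟩ := hω
    have hoa : o ≠ a := fun h' => hoA (h' ▸ ha)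
    obtain ⟨x, hxo, hx⟩ := addLemma13_exists_open_pair hoa h
    exact ⟨s(o, x), Finset.mem_image.2 ⟨x, by simp [hxo], rfl⟩, hx⟩
  have hle : (prodBernoulli w).real (⋃ a ∈ A, openConn o a) ≤ ∑ i ∈ F, (w i : ℝ) :=
    (measureReal_mono hsub).trans (prodBernoulli_real_exists_mem_le_sum w F)
  have hsum : ∑ i ∈ F, (w i : ℝ) = 0 := by
    refine Finset.sum_eq_zero fun i hi => ?_
    obtain ⟨x, hx, rfl⟩ := Finset.mem_image.1 hi
    simp only [Finset.mem_filter, Finset.mem_univ, true_and] at hx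
    simp [hiso x hx]
  exact le_antisymm (hle.trans hsum.le) measureReal_nonneg

/-- The affine algebra of the additive Lemma 13: with `X = (1−p)X₀ + pX₁` etc., `Y₀ − (1 − Z₀) ≤ X₀`,
`Y₁ − (1 − Z₁) ≤ X₁`, `0 ≤ p ≤ 1` and `t ≤ Z` give `Y − (1 − t) ≤ X`, because
`X − Y + 1 − Z = (1−p)(X₀ − Y₀ + 1 − Z₀) + p(X₁ − Y₁ + 1 − Z₁)` (no cross term). [folklore] -/
theorem addLemma13_algebra {p X₀ X₁ Y₀ Y₁ Z₀ Z₁ t : ℝ} (hp0 : 0 ≤ p) (hp1 : p ≤ 1)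
    (h0 : Y₀ - (1 - Z₀) ≤ X₀) (h1 : Y₁ - (1 - Z₁) ≤ X₁) (ht : t ≤ (1 - p) * Z₀ + p * Z₁) :
    (1 - p) * Y₀ + p * Y₁ - (1 - t) ≤ (1 - p) * X₀ + p * X₁ := by
  have hq : 0 ≤ 1 - p := sub_nonneg.2 hp1
  have h4 : 0 ≤ (1 - p) * (X₀ - (Y₀ - (1 - Z₀))) := mul_nonneg hq (sub_nonneg.2 h0)
  have h5 : 0 ≤ p * (X₁ - (Y₁ - (1 - Z₁))) := mul_nonneg hp0 (sub_nonneg.2 h1)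
  have e : (1 - p) * X₀ + p * X₁ - ((1 - p) * Y₀ + p * Y₁ - (1 - ((1 - p) * Z₀ + p * Z₁))) =
      (1 - p) * (X₀ - (Y₀ - (1 - Z₀))) + p * (X₁ - (Y₁ - (1 - Z₁))) := by
    ring
  linarith [e, h4, h5]

/-- **Additive Kozma–Nitzan Lemma 13: the additive shortening step (with the induction hypothesis displayed)
implies additive Conjecture 1** (registered stub `stub_additiveLemma13` of the line `additive-shortening` of crux
`PercNearOneGluing.NoHeavyLowerTail`, verbatim signature).  Informally: if, for every weight function `w` with
`w s(v,x) = 0`, `v ∉ A`, `v ≠ x`, every minimiser `a₀ ∈ A` of `P_w(· ↔ b)` and additive Conjecture 1 known below the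
support of `w`, one has `P_{w[s(v,x)↦1]}(v ↔ A) − (1 − P_{w[s(v,x)↦1]}(a₀ ↔ b)) ≤ P_{w[s(v,x)↦1]}(v ↔ b)`, then for
all `w`, `A ≠ ∅`, `o`, `b` and `t ≤ min_{a ∈ A} P_w(a ↔ b)`: `P_w(o ↔ A) − (1 − t) ≤ P_w(o ↔ b)`.  Strong induction on
the number of positive pairs, one-bond decomposition and the affine identity of the module docstring (the additive
rerun of the proof sketch of Kozma–Nitzan, arXiv:2401.12397, §5.3 Lemma 13 p. 34). [folklore] -/
theorem stub_additiveLemma13 : (∀ (n : ℕ) (w : Sym2 (Fin n) → unitInterval) (A : Finset (Fin n)) (b v x a₀ : Fin n), v ∉ A → v ≠ x → w s(v, x) = 0 → a₀ ∈ A → (∀ a ∈ A, (prodBernoulli w).real (openConn a₀ b) ≤ (prodBernoulli w).real (openConn a b)) → (∀ w' : Sym2 (Fin n) → unitInterval, (∀ e, w e = 0 → w' e = 0) → ∀ (A' : Finset (Fin n)) (o' b' : Fin n) (t : ℝ), A'.Nonempty → (∀ a ∈ A', t ≤ (prodBernoulli w').real (openConn a b')) → (prodBernoulli w').real (⋃ a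 ∈ A', openConn o' a) - (1 - t) ≤ (prodBernoulli w').real (openConn o' b')) → (prodBernoulli (Function.update w s(v, x) 1)).real (⋃ a ∈ A, openConn v a) - (1 - (prodBernoulli (Function.update w s(v, x) 1)).real (openConn a₀ b)) ≤ (prodBernoulli (Function.update w s(v, x) 1)).real (openConn v b)) → ∀ (n : ℕ) (w : Sym2 (Fin n) → unitInterval) (A : Finset (Fin n)) (o b : Fin n) (t : ℝ), A.Nonempty → (∀ a ∈ A, t ≤ (prodBernoulli w).real (openConn a b)) → (prodBernoulli w).real (⋃ a ∈ A, openConn o a) - (1 - t) ≤ (prodBernoulli w).real (openConn o b) := by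
  intro hStep n
  -- strong induction on the number of positive pairs
  suffices H : ∀ k : ℕ, ∀ w : Sym2 (Fin n) → unitInterval,
      (Finset.univ.filter fun e => w e ≠ 0).card = k →
      ∀ (A : Finset (Fin n)) (o b : Fin n) (t : ℝ), A.Nonempty →
        (∀ a ∈ A, t ≤ (prodBernoulli w).real (openConn a b)) →
        (prodBernoulli w).real (⋃ a ∈ A, openConn o a) - (1 - t) ≤ (prodBernoulli w).real (openConn o b) by
    intro w A o b t hA ht
    exact H _ w rfl A o b t hA ht
  intro k
  induction k using Nat.strong_induction_on with
  | _ k ih =>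
  intro w hk A o b t hA ht
  have hY1 : (prodBernoulli w).real (⋃ a ∈ A, openConn o a) ≤ 1 := measureReal_le_one
  have hX0 : 0 ≤ (prodBernoulli w).real (openConn o b) := measureReal_nonneg
  -- case `o ∈ A`: `t ≤ P(o ↔ b)` is a hypothesis and `P(o ↔ A) ≤ 1`
  by_cases hoA : o ∈ A
  · have hob := ht o hoA
    linarith
  -- case: every pair at `o` has weight `0`; then `P(o ↔ A) = 0` and `t ≤ P(a ↔ b) ≤ 1` for some `a ∈ A`
  by_cases hiso : ∀ x : Fin n, x ≠ o → w s(o, x) = 0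
  · rw [addLemma13_reach_eq_zero w A hoA hiso]
    obtain ⟨a, ha⟩ := hA
    have hab : (prodBernoulli w).real (openConn a b) ≤ 1 := measureReal_le_one
    have hta := ht a ha
    linarith
  push Not at hiso
  obtain ⟨x, hxo, hwx⟩ := hiso
  have hox : o ≠ x := fun h => hxo h.symm
  -- the two endpoint weight functions
  have hupd0 : Function.update w s(o, x) 0 s(o, x) = 0 := Function.update_self ..
  -- the support of `w[e ↦ 0]` is strictly smaller
  have hcard : (Finset.univ.filter fun e => Function.update w s(o, x) 0 e ≠ 0).card < k := by
    rw [← hk]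
    refine Finset.card_lt_card ⟨?_, ?_⟩
    · intro e he
      simp only [Finset.mem_filter, Finset.mem_univ, true_and, Function.update_apply] at he ⊢
      split_ifs at he with h
      · exact absurd rfl he
      · exact he
    · intro hsub
      have := hsub (show s(o, x) ∈ Finset.univ.filter (fun e => w e ≠ 0) by simp [hwx])
      simp at this
  -- induction hypothesis for every weight function supported inside the support of `w[e ↦ 0]`
  have hIH : ∀ w' : Sym2 (Fin n) → unitInterval, (∀ e, Function.update w s(o, x) 0 e = 0 → w' e = 0) →
      ∀ (A' : Finset (Fin n)) (o' b' : Fin n) (t' : ℝ), A'.Nonempty →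
        (∀ a ∈ A', t' ≤ (prodBernoulli w').real (openConn a b')) →
        (prodBernoulli w').real (⋃ a ∈ A', openConn o' a) - (1 - t') ≤
          (prodBernoulli w').real (openConn o' b') := by
    intro w' hw' A' o' b' t' hA' ht'
    refine ih _ ?_ w' rfl A' o' b' t' hA' ht'
    refine lt_of_le_of_lt (Finset.card_le_card ?_) hcard
    intro e he
    simp only [Finset.mem_filter, Finset.mem_univ, true_and] at he ⊢
    exact fun h0 => he (hw' e h0)
  -- the minimiser `a₀` for `w[e ↦ 0]`
  obtain ⟨a₀, ha₀, hmin⟩ :=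
    A.exists_min_image (fun a => (prodBernoulli (Function.update w s(o, x) 0)).real (openConn a b)) hA
  -- the step at `w[e ↦ 0]`: additive Conjecture 1's inequality for `w[e ↦ 1]` against `a₀`
  have hstep := hStep n (Function.update w s(o, x) 0) A b o x a₀ hoA hox hupd0 ha₀ hmin hIH
  simp only [Function.update_idem] at hstep
  -- induction at `w[e ↦ 0]` itself with `t := Z₀`
  have h0 := hIH (Function.update w s(o, x) 0) (fun e h => h) A o b
    ((prodBernoulli (Function.update w s(o, x) 0)).real (openConn a₀ b)) hA hmin
  -- one-bond decompositions of `X, Y, Z`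
  have hX := stub_oneBondDecomp_k15 n w s(o, x) (openConn o b)
  have hY := stub_oneBondDecomp_k15 n w s(o, x) (⋃ a ∈ A, openConn o a)
  have hZ := stub_oneBondDecomp_k15 n w s(o, x) (openConn a₀ b)
  have hp0 : 0 ≤ (w s(o, x) : ℝ) := (w s(o, x)).2.1
  have hp1 : (w s(o, x) : ℝ) ≤ 1 := (w s(o, x)).2.2
  have ht' := ht a₀ ha₀
  rw [hZ] at ht'
  rw [hX, hY]
  exact addLemma13_algebra hp0 hp1 h0 hstep ht'

end AddLemma13

end Summit.CriticalPhenomena.PercolationContinuityZ3.Theorems
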